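import Summits.QuantumFields.YangMills.Theorems.UnitScaleTiltFluctuationComparisonRegPrLiftFaceCert

/-!
# Route `UnitScaleTilt` — crux `FluctuationComparisonRegPrL` (stmt-QuantumFields-19935), stub `stub_oneStepSmallLift`, piece (L2):
# GENERIC KERNEL-REFLECTION LEMMAS for the de-nativised `L = 3` certificate (support file `--supports stmt-QuantumFields-19935`)

Fleet seat `ym-ust-19201-p2` gen 5 (OWNER RULING g20-№9 §3, task «DE-NATIVE CertL3Tree»).  The five certificate facts of
`…CertL3Tree` (`faceQ`, `sneutralQ`, `massQ`, `chainMassQ`, `rowsQ`) were proved by `native_decide`; to re-prove them inside the kernel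
one must avoid evaluating the dense `Fintype`-indexed statements (30 375 table look-ups each, `Fintype` pi-instances) and instead push every
sum forward to the SPARSE entry lists (156 + 58 entries).  This file is the table-independent half of that reflection:

* §1 list algebra (`filter/map/sum` as `ite`-sums, exchange of a `Finset.sum` with a list sum, triangle inequality, pushing `ite` inside);
* §2 enumeration of the small index types (`Fin 3 → α` as triples, `Orient 3`, ordered pairs, the unique `Tri 3`, `Fin n` via `List.finRange`);
* §3 the fibre count of `r ↦ Function.update r a t` on `Fin 3 → Fin 3` (multiplicity `3`);
* §4 DECODING of a table entry given by raw `ℕ` coordinates (accessor functions on an arbitrary entry type `α`): the Boolean match used by the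
  tables is true at exactly one dense index, whence the COLLAPSE lemmas for the sums over orientations/displacements, over updates, and over cubes;
* (sequel `…CertReflectKeyed`: §5 the fibrewise (`keyed`) `ℓ¹` mass against the grouped mass of a (key, coefficient) list; §6 encoded
  keys and the entry-driven bond fibre sums).

Elementary bookkeeping; nothing of Bałaban's is asserted.
-/

open scoped BigOperators

namespace Summit.QuantumFields.YangMills.Theorems.ApproxLift.CertReflect

open Summit.QuantumFields.YangMills.Theorems.ApproxLift

/-! ## §1 List algebra -/

/-- `filter/map/sum` as a list sum of `ite`. -/
theorem sum_map_filter {α : Type*} (l : List α) (P : α → Bool) (g : α → ℚ) :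
    ((l.filter P).map g).sum = (l.map fun e => if P e = true then g e else 0).sum := by
  induction l with
  | nil => simp
  | cons e l ih =>
    simp only [List.filter_cons, List.map_cons, List.sum_cons]
    split_ifs with h
    · simp only [List.map_cons, List.sum_cons, ih]
    · simp only [ih, zero_add]

/-- Exchange of a `Finset.sum` with a list sum. -/
theorem finset_sum_list_sum {α β : Type*} (s : Finset β) (l : List α) (g : β → α → ℚ) :
    (∑ x ∈ s, (l.map (g x)).sum) = (l.map fun e => ∑ x ∈ s, g x e).sum := by
  induction l with
  | nil => simp
  | cons e l ih => simp only [List.map_cons, List.sum_cons, Finset.sum_add_distrib, ih]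

/-- Triangle inequality for a list sum. -/
theorem abs_sum_map_le {α : Type*} (l : List α) (f : α → ℚ) : |(l.map f).sum| ≤ (l.map fun e => |f e|).sum := by
  induction l with
  | nil => simp
  | cons e l ih =>
    simp only [List.map_cons, List.sum_cons]
    exact (abs_add_le _ _).trans (by gcongr)

/-- Pushing a scalar `ite` inside a list sum of `ite`s. -/
theorem ite_mul_sum_map {α : Type*} (A : Prop) [Decidable A] (r : ℚ) (l : List α) (M : α → Bool) (v : α → ℚ) :
    (if A then r * (l.map fun e => if M e = true then v e else 0).sum else 0) =
      (l.map fun e => if M e = true then (if A then r * v e else 0) else 0).sum := by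
  split_ifs with hA
  · rw [← List.sum_map_mul_left]
    exact congrArg List.sum (List.map_congr_left fun e _ => by split_ifs <;> simp)
  · symm
    exact List.sum_eq_zero (fun x hx => by
      obtain ⟨e, _, rfl⟩ := List.mem_map.1 hx
      split_ifs <;> rfl)

/-- Splitting a guarded sum of two summands. -/
theorem sum_map_ite_add {α : Type*} (l : List α) (C : α → Prop) [DecidablePred C] (f g : α → ℚ) :
    (l.map fun e => if C e then f e + g e else 0).sum =
      (l.map fun e => if C e then f e else 0).sum + (l.map fun e => if C e then g e else 0).sum := by
  rw [← List.sum_map_add]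
  exact congrArg List.sum (List.map_congr_left fun e _ => by split_ifs <;> simp)

/-- `filter/map/filter/map/sum` of a (key, coefficient) list built from a filtered entry list, as one `ite`-sum. -/
theorem sum_filter_map_filter {α κ : Type*} [DecidableEq κ] (l : List α) (C : α → Prop) [DecidablePred C] (F : α → κ × ℚ) (kc : κ) :
    ((((l.filter fun e => C e).map F).filter fun x => x.1 = kc).map Prod.snd).sum =
      (l.map fun e => if C e then (if (F e).1 = kc then (F e).2 else 0) else 0).sum := by
  induction l with
  | nil => simp
  | cons e l ih =>
    simp only [List.filter_cons, List.map_cons, List.sum_cons]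
    by_cases hC : C e
    · simp only [hC, decide_true, if_true, List.map_cons, List.filter_cons]
      by_cases hk : (F e).1 = kc
      · simp only [hk, decide_true, if_true, List.map_cons, List.sum_cons, ih]
      · simp only [hk, decide_false, if_false, ih, zero_add, Bool.false_eq_true]
    · simp only [hC, decide_false, if_false, ih, zero_add, Bool.false_eq_true]

/-- Head step of `filter/map Prod.snd/sum` on a (key, coefficient) list. -/
theorem sum_filter_snd_cons {κ : Type*} [DecidableEq κ] (x : κ × ℚ) (l : List (κ × ℚ)) (kc : κ) :
    ((((x :: l).filter fun y => y.1 = kc).map Prod.snd).sum) =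
      (if x.1 = kc then x.2 else 0) + (((l.filter fun y => y.1 = kc).map Prod.snd).sum) := by
  simp only [List.filter_cons]
  by_cases h : x.1 = kc
  · simp [h]
  · simp [h]

/-- `filter/map Prod.snd/sum` over an appended (key, coefficient) list. -/
theorem sum_filter_snd_append {κ : Type*} [DecidableEq κ] (l₁ l₂ : List (κ × ℚ)) (kc : κ) :
    ((((l₁ ++ l₂).filter fun y => y.1 = kc).map Prod.snd).sum) =
      (((l₁.filter fun y => y.1 = kc).map Prod.snd).sum) + (((l₂.filter fun y => y.1 = kc).map Prod.snd).sum) := by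
  simp [List.filter_append, List.map_append, List.sum_append]

/-- `filter/map Prod.snd/sum` through a `flatMap` of a filtered entry list. -/
theorem sum_filter_flatMap_filter {α κ : Type*} [DecidableEq κ] (l : List α) (C : α → Prop) [DecidablePred C] (F : α → List (κ × ℚ)) (kc : κ) :
    ((((l.filter fun e => C e).flatMap F).filter fun x => x.1 = kc).map Prod.snd).sum =
      (l.map fun e => if C e then ((((F e).filter fun x => x.1 = kc).map Prod.snd).sum) else 0).sum := by
  induction l with
  | nil => simp
  | cons e l ih =>
    simp only [List.filter_cons, List.map_cons, List.sum_cons]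
    by_cases hC : C e
    · simp only [hC, decide_true, if_true, List.flatMap_cons, sum_filter_snd_append, ih]
    · simp only [hC, decide_false, if_false, ih, zero_add, Bool.false_eq_true]

/-! ## §2 Enumeration of the small index types -/

/-- Functions on `Fin 3` are triples. -/
theorem forall_pi3 {α : Type*} {P : (Fin 3 → α) → Prop} : (∀ p, P p) ↔ ∀ a b c, P ![a, b, c] :=
  ⟨fun h a b c => h _, fun h p => by
    have hp : p = ![p 0, p 1, p 2] := by funext i; fin_cases i <;> rfl
    rw [hp]; exact h _ _ _⟩

/-- `Fin n` is enumerated by `List.finRange n`. -/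
theorem forall_mem_finRange {n : ℕ} {P : Fin n → Prop} : (∀ i, P i) ↔ ∀ i ∈ List.finRange n, P i :=
  ⟨fun h i _ => h i, fun h i => h i (List.mem_finRange i)⟩

/-- The three orientations of `d = 3`. -/
theorem forall_orient3 {P : Orient 3 → Prop} :
    (∀ o, P o) ↔ P ⟨(0, 1), by decide⟩ ∧ P ⟨(0, 2), by decide⟩ ∧ P ⟨(1, 2), by decide⟩ := by
  refine ⟨fun h => ⟨h _, h _, h _⟩, fun ⟨h01, h02, h12⟩ o => ?_⟩
  obtain ⟨⟨i, j⟩, hij⟩ := o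
  fin_cases i <;> fin_cases j <;>
    first | exact h01 | exact h02 | exact h12 | exact absurd hij (by decide)

/-- The three ordered pairs of directions of `d = 3`. -/
theorem forall_lt3 {P : ∀ μ ν : Fin 3, μ < ν → Prop} :
    (∀ μ ν (h : μ < ν), P μ ν h) ↔ P 0 1 (by decide) ∧ P 0 2 (by decide) ∧ P 1 2 (by decide) := by
  refine ⟨fun h => ⟨h _ _ _, h _ _ _, h _ _ _⟩, fun ⟨h01, h02, h12⟩ μ ν hμν => ?_⟩
  fin_cases μ <;> fin_cases ν <;>
    first | exact h01 | exact h02 | exact h12 | exact absurd hμν (by decide)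

/-- `d = 3` has exactly one ordered triple of directions. -/
theorem tri3_eq (τ : Tri 3) : τ = ⟨(0, 1, 2), by decide, by decide⟩ := by
  obtain ⟨⟨a, b, c⟩, hab, hbc⟩ := τ
  fin_cases a <;> fin_cases b <;> fin_cases c <;>
    first | rfl | exact absurd hab (by decide) | exact absurd hbc (by decide)

/-- A sum over `Tri 3` is its value at `(0,1,2)`. -/
theorem sum_tri3 (f : Tri 3 → ℚ) : ∑ τ, f τ = f ⟨(0, 1, 2), by decide, by decide⟩ := by
  have hu : (Finset.univ : Finset (Tri 3)) = {⟨(0, 1, 2), by decide, by decide⟩} :=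
    Finset.eq_singleton_iff_unique_mem.2 ⟨Finset.mem_univ _, fun τ _ => tri3_eq τ⟩
  rw [hu, Finset.sum_singleton]

/-! ## §3 The fibre count of `r ↦ update r a t` -/

/-- On `Fin 3 → Fin 3`, the map `r ↦ Function.update r a t` hits `q` exactly `3` times if `q a = t`, and never otherwise. -/
theorem sum_update_indicator (q : Fin 3 → Fin 3) (a t : Fin 3) :
    (∑ r : Fin 3 → Fin 3, if Function.update r a t = q then (1 : ℚ) else 0) = if q a = t then 3 else 0 := by
  rw [Finset.sum_boole]
  split_ifs with hqa
  · have hset : (Finset.univ.filter fun r : Fin 3 → Fin 3 => Function.update r a t = q) =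
        Finset.univ.image fun j : Fin 3 => Function.update q a j := by
      ext r
      simp only [Finset.mem_filter, Finset.mem_univ, true_and, Finset.mem_image]
      constructor
      · intro hr
        refine ⟨r a, ?_⟩
        rw [← hr, Function.update_idem, Function.update_eq_self]
      · rintro ⟨j, rfl⟩
        rw [Function.update_idem, ← hqa, Function.update_eq_self]
    have hinj : Function.Injective fun j : Fin 3 => Function.update q a j := fun j j' hjj' => by
      simpa using congr_fun hjj' a
    rw [hset, Finset.card_image_of_injective _ hinj, Finset.card_univ, Fintype.card_fin]
    norm_num
  · have hset : (Finset.univ.filter fun r : Fin 3 → Fin 3 => Function.update r a t = q) = ∅ := by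
      ext r
      simp only [Finset.mem_filter, Finset.mem_univ, true_and, Finset.notMem_empty, iff_false]
      intro hr
      exact hqa (by rw [← hr, Function.update_self])
    rw [hset]
    simp


/-! ## §4 Decoding a table entry from raw coordinates; the collapse lemmas -/

/-- Two functions on `Fin 3` agree iff they agree at `0, 1, 2`. -/
theorem vec3_eq {α : Type*} {f g : Fin 3 → α} (h0 : f 0 = g 0) (h1 : f 1 = g 1) (h2 : f 2 = g 2) : f = g := by
  funext i; fin_cases i <;> assumption

/-- Raw coordinates below a bound come from a `Fin`-valued triple. -/
theorem exists_vec3 {n : ℕ} (x y z : ℕ) (hx : x < n) (hy : y < n) (hz : z < n) :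
    ∃ v : Fin 3 → Fin n, x = v 0 ∧ y = v 1 ∧ z = v 2 :=
  ⟨![⟨x, hx⟩, ⟨y, hy⟩, ⟨z, hz⟩], rfl, rfl, rfl⟩

/-- The value of the raw offset triple at a direction, read off a `Fin`-valued decoding. -/
theorem vec3_nat_apply (x y z : ℕ) (q : Fin 3 → Fin 3) (h0 : x = q 0) (h1 : y = q 1) (h2 : z = q 2) (a : Fin 3) :
    ((![x, y, z] : Fin 3 → ℕ) a) = (q a : ℕ) := by
  fin_cases a
  · simpa using h0
  · simpa using h1
  · simpa using h2

section Decode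

variable {α : Type*} (fa fp0 fp1 fp2 fo fk0 fk1 fk2 : α → ℕ) (oi : Orient 3 → ℕ) {L : ℕ}

/-- The Boolean match of a kernel-table entry against a dense index `(a, p, o, k)` is the conjunction of the eight coordinate equalities. -/
theorem mk_iff (e : α) (a : Fin 3) (p : Fin 3 → Fin L) (o : Orient 3) (k : Fin 3 → Fin (2 * 2 + 1)) :
    (fa e == (a : ℕ) && fp0 e == (p 0 : ℕ) && fp1 e == (p 1 : ℕ) && fp2 e == (p 2 : ℕ) && fo e == oi o &&
        fk0 e == (k 0 : ℕ) && fk1 e == (k 1 : ℕ) && fk2 e == (k 2 : ℕ)) = true ↔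
      fa e = a ∧ fp0 e = p 0 ∧ fp1 e = p 1 ∧ fp2 e = p 2 ∧ fo e = oi o ∧ fk0 e = k 0 ∧ fk1 e = k 1 ∧ fk2 e = k 2 := by
  simp only [Bool.and_eq_true, beq_iff_eq, and_assoc]

/-- COLLAPSE over (orientation, displacement): for fixed `(a, p)` the match selects at most the one index `(o₀, k₀)` decoding the entry. -/
theorem collapse_ok (hoi : Function.Injective oi) (e : α) (g : Orient 3 → (Fin 3 → Fin (2 * 2 + 1)) → ℚ)
    (a : Fin 3) (p : Fin 3 → Fin L) (o₀ : Orient 3) (k₀ : Fin 3 → Fin (2 * 2 + 1))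
    (ho : fo e = oi o₀) (hk0 : fk0 e = k₀ 0) (hk1 : fk1 e = k₀ 1) (hk2 : fk2 e = k₀ 2) :
    (∑ o : Orient 3, ∑ k : Fin 3 → Fin (2 * 2 + 1),
        if (fa e == (a : ℕ) && fp0 e == (p 0 : ℕ) && fp1 e == (p 1 : ℕ) && fp2 e == (p 2 : ℕ) && fo e == oi o &&
            fk0 e == (k 0 : ℕ) && fk1 e == (k 1 : ℕ) && fk2 e == (k 2 : ℕ)) = true then g o k else 0) =
      if fa e = a ∧ fp0 e = p 0 ∧ fp1 e = p 1 ∧ fp2 e = p 2 then g o₀ k₀ else 0 := by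
  have key : ∀ (o : Orient 3) (k : Fin 3 → Fin (2 * 2 + 1)),
      ((fa e == (a : ℕ) && fp0 e == (p 0 : ℕ) && fp1 e == (p 1 : ℕ) && fp2 e == (p 2 : ℕ) && fo e == oi o &&
          fk0 e == (k 0 : ℕ) && fk1 e == (k 1 : ℕ) && fk2 e == (k 2 : ℕ)) = true) ↔
        ((fa e = a ∧ fp0 e = p 0 ∧ fp1 e = p 1 ∧ fp2 e = p 2) ∧ (o = o₀ ∧ k = k₀)) := by
    intro o k
    rw [mk_iff]
    constructor
    · rintro ⟨h1, h2, h3, h4, h5, h6, h7, h8⟩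
      exact ⟨⟨h1, h2, h3, h4⟩, hoi (h5.symm.trans ho),
        vec3_eq (Fin.ext (h6.symm.trans hk0)) (Fin.ext (h7.symm.trans hk1)) (Fin.ext (h8.symm.trans hk2))⟩
    · rintro ⟨⟨h1, h2, h3, h4⟩, rfl, rfl⟩
      exact ⟨h1, h2, h3, h4, ho, hk0, hk1, hk2⟩
  simp_rw [key]
  by_cases hc : (fa e = a ∧ fp0 e = p 0 ∧ fp1 e = p 1 ∧ fp2 e = p 2)
  · simp only [hc, true_and, if_true]
    rw [Finset.sum_eq_single o₀ (fun o _ hne => Finset.sum_eq_zero fun k _ => if_neg fun hh => hne hh.1)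
      (fun hh => absurd (Finset.mem_univ _) hh)]
    rw [Finset.sum_eq_single k₀ (fun k _ hne => if_neg fun hh => hne hh.2) (fun hh => absurd (Finset.mem_univ _) hh)]
    simp
  · simp only [hc, false_and, if_false, Finset.sum_const_zero]

/-- COLLAPSE over the updates `r ↦ update r a t` (the S-neutrality shape, block size `3`): the match selects the `3` functions `r` agreeing with
the entry's offsets off `a`, provided the entry's `a`-th offset is `t`. -/
theorem collapse_update (e : α) (w : ℚ) (a t : Fin 3) (o : Orient 3) (k : Fin 3 → Fin (2 * 2 + 1))
    (p₀ : Fin 3 → Fin 3) (hp0 : fp0 e = p₀ 0) (hp1 : fp1 e = p₀ 1) (hp2 : fp2 e = p₀ 2) :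
    (∑ r : Fin 3 → Fin 3,
        if (fa e == (a : ℕ) && fp0 e == (Function.update r a t 0 : ℕ) && fp1 e == (Function.update r a t 1 : ℕ) &&
            fp2 e == (Function.update r a t 2 : ℕ) && fo e == oi o &&
            fk0 e == (k 0 : ℕ) && fk1 e == (k 1 : ℕ) && fk2 e == (k 2 : ℕ)) = true then w else 0) =
      if fk0 e = k 0 ∧ fk1 e = k 1 ∧ fk2 e = k 2 ∧ fa e = a ∧ fo e = oi o ∧ ((![fp0 e, fp1 e, fp2 e] : Fin 3 → ℕ) a) = (t : ℕ)
      then 3 * w else 0 := by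
  have key : ∀ r : Fin 3 → Fin 3,
      ((fa e == (a : ℕ) && fp0 e == (Function.update r a t 0 : ℕ) && fp1 e == (Function.update r a t 1 : ℕ) &&
            fp2 e == (Function.update r a t 2 : ℕ) && fo e == oi o &&
            fk0 e == (k 0 : ℕ) && fk1 e == (k 1 : ℕ) && fk2 e == (k 2 : ℕ)) = true) ↔
        ((fk0 e = k 0 ∧ fk1 e = k 1 ∧ fk2 e = k 2 ∧ fa e = a ∧ fo e = oi o) ∧ Function.update r a t = p₀) := by
    intro r
    rw [mk_iff]
    constructor
    · rintro ⟨h1, h2, h3, h4, h5, h6, h7, h8⟩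
      exact ⟨⟨h6, h7, h8, h1, h5⟩,
        vec3_eq (Fin.ext (h2.symm.trans hp0)) (Fin.ext (h3.symm.trans hp1)) (Fin.ext (h4.symm.trans hp2))⟩
    · rintro ⟨⟨h6, h7, h8, h1, h5⟩, hr⟩
      rw [hr]
      exact ⟨h1, hp0, hp1, hp2, h5, h6, h7, h8⟩
  simp_rw [key]
  have hpa : (((![fp0 e, fp1 e, fp2 e] : Fin 3 → ℕ) a) = (t : ℕ)) ↔ p₀ a = t := by
    rw [vec3_nat_apply (fp0 e) (fp1 e) (fp2 e) p₀ hp0 hp1 hp2 a]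
    exact Fin.val_inj
  by_cases hc : (fk0 e = k 0 ∧ fk1 e = k 1 ∧ fk2 e = k 2 ∧ fa e = a ∧ fo e = oi o)
  · simp only [hc, true_and]
    rw [if_congr hpa rfl rfl]
    calc (∑ r : Fin 3 → Fin 3, if Function.update r a t = p₀ then w else 0)
        = w * ∑ r : Fin 3 → Fin 3, (if Function.update r a t = p₀ then (1 : ℚ) else 0) := by
          rw [Finset.mul_sum]
          exact Finset.sum_congr rfl (fun r _ => by split_ifs <;> simp)
      _ = if p₀ a = t then 3 * w else 0 := by rw [sum_update_indicator]; split_ifs <;> ring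
  · have hc' : ∀ X : Prop, ¬ (fk0 e = k 0 ∧ fk1 e = k 1 ∧ fk2 e = k 2 ∧ fa e = a ∧ fo e = oi o ∧ X) := fun X hh =>
      hc ⟨hh.1, hh.2.1, hh.2.2.1, hh.2.2.2.1, hh.2.2.2.2.1⟩
    simp only [hc, false_and, if_false, Finset.sum_const_zero, hc']

end Decode

section DecodeE

variable {α : Type*} (gop gq0 gq1 gq2 gm0 gm1 gm2 : α → ℕ) (oi : Orient 3 → ℕ) {L : ℕ}

/-- The Boolean match of a chain-table entry against a dense index (class, cube) is the conjunction of the seven coordinate equalities. -/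
theorem me_iff (ε : α) (μ ν : Fin 3) (h : μ < ν) (pp : Fin 3 → Fin L) (q : Fin 3 → Fin (2 * (2 + 1) + 1)) :
    (gop ε == oi ⟨(μ, ν), h⟩ && gq0 ε == (pp 0 : ℕ) && gq1 ε == (pp 1 : ℕ) && gq2 ε == (pp 2 : ℕ) &&
        gm0 ε == (q 0 : ℕ) && gm1 ε == (q 1 : ℕ) && gm2 ε == (q 2 : ℕ)) = true ↔
      gop ε = oi ⟨(μ, ν), h⟩ ∧ gq0 ε = pp 0 ∧ gq1 ε = pp 1 ∧ gq2 ε = pp 2 ∧ gm0 ε = q 0 ∧ gm1 ε = q 1 ∧ gm2 ε = q 2 := by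
  simp only [Bool.and_eq_true, beq_iff_eq, and_assoc]

/-- COLLAPSE over the cubes: for a fixed class the match selects at most the one cube `q₀` decoding the entry. -/
theorem collapseE (ε : α) (g : (Fin 3 → Fin (2 * (2 + 1) + 1)) → ℚ) (μ ν : Fin 3) (h : μ < ν) (pp : Fin 3 → Fin L)
    (q₀ : Fin 3 → Fin (2 * (2 + 1) + 1)) (hq0 : gm0 ε = q₀ 0) (hq1 : gm1 ε = q₀ 1) (hq2 : gm2 ε = q₀ 2) :
    (∑ q : Fin 3 → Fin (2 * (2 + 1) + 1),
        if (gop ε == oi ⟨(μ, ν), h⟩ && gq0 ε == (pp 0 : ℕ) && gq1 ε == (pp 1 : ℕ) && gq2 ε == (pp 2 : ℕ) &&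
            gm0 ε == (q 0 : ℕ) && gm1 ε == (q 1 : ℕ) && gm2 ε == (q 2 : ℕ)) = true then g q else 0) =
      if gop ε = oi ⟨(μ, ν), h⟩ ∧ gq0 ε = pp 0 ∧ gq1 ε = pp 1 ∧ gq2 ε = pp 2 then g q₀ else 0 := by
  have key : ∀ q : Fin 3 → Fin (2 * (2 + 1) + 1),
      ((gop ε == oi ⟨(μ, ν), h⟩ && gq0 ε == (pp 0 : ℕ) && gq1 ε == (pp 1 : ℕ) && gq2 ε == (pp 2 : ℕ) &&
          gm0 ε == (q 0 : ℕ) && gm1 ε == (q 1 : ℕ) && gm2 ε == (q 2 : ℕ)) = true) ↔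
        ((gop ε = oi ⟨(μ, ν), h⟩ ∧ gq0 ε = pp 0 ∧ gq1 ε = pp 1 ∧ gq2 ε = pp 2) ∧ q = q₀) := by
    intro q
    rw [me_iff]
    constructor
    · rintro ⟨h1, h2, h3, h4, h5, h6, h7⟩
      exact ⟨⟨h1, h2, h3, h4⟩, vec3_eq (Fin.ext (h5.symm.trans hq0)) (Fin.ext (h6.symm.trans hq1)) (Fin.ext (h7.symm.trans hq2))⟩
    · rintro ⟨⟨h1, h2, h3, h4⟩, rfl⟩
      exact ⟨h1, h2, h3, h4, hq0, hq1, hq2⟩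
  simp_rw [key]
  by_cases hc : (gop ε = oi ⟨(μ, ν), h⟩ ∧ gq0 ε = pp 0 ∧ gq1 ε = pp 1 ∧ gq2 ε = pp 2)
  · simp only [hc, true_and, if_true]
    rw [Finset.sum_eq_single q₀ (fun q _ hne => if_neg fun hh => hne hh) (fun hh => absurd (Finset.mem_univ _) hh)]
    simp
  · simp only [hc, false_and, if_false, Finset.sum_const_zero]

end DecodeE

end Summit.QuantumFields.YangMills.Theorems.ApproxLift.CertReflect
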